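import Mathlib.Algebra.Homology.BifunctorShift
import Mathlib.Algebra.Homology.HomotopyCategory.ShiftSequence
import Mathlib.Algebra.Homology.HomotopyCategory.SingleFunctors
import Mathlib.Algebra.Homology.QuasiIso
import HarnessLib

/-!
# The total complex `F(E₀[0], K•)` of a bifunctor at a one-term complex is `F(E₀, –)` applied termwise to `K•`
# (column isomorphism), and the base case «`F(E₀[k], –)•` preserves the quasi-isomorphisms that `F(E₀, –)•` preserves»

Layer `Literature/Algebra/Homology` (pure homological algebra over Mathlib; 0 named facts, no instances). For a bifunctor
`F : C₁ ⥤ C₂ ⥤ D` (additive in each variable), an object `E₀ : C₁` and a cochain complex `K : CochainComplex C₂ ℤ`, Mathlib's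
`HomologicalComplex.mapBifunctor E₀[0] K F` — the total complex of the bicomplex `(i, j) ↦ F(E₀[0]ⁱ, Kʲ)` — has only the summands
`(0, j)`, and on them the total differential is `F(E₀[0]⁰, d_K)` with the sign `ε₂(0, j) = (-1)⁰ = 1`; hence

* `columnIso F E₀ K : mapBifunctor ((single C₁ (up ℤ) 0).obj E₀) K F (up ℤ) ≅ ((F.obj E₀).mapHomologicalComplex (up ℤ)).obj K`,
  natural in `K` (`columnIso_hom_naturality`) — Weibel 2.7.1 / Stacks 012Z with one factor concentrated in degree `0`;
* `quasiIso_mapBifunctorMap_single₀` — if `F(E₀, –)•φ` is a quasi-isomorphism then so is `F(E₀[0], –)•φ := mapBifunctorMap (𝟙 E₀[0]) φ`;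
* `quasiIso_map₂_obj_map_iff_of_iso`, `quasiIso_map₂_obj_shift_map_iff` — invariance of that property under `E ≅ E'` and under
  shifting `E` (Mathlib `mapBifunctorShift₁Iso`, packaged as the `CommShift` structure of `F.map₂CochainComplex.flip.obj K`, and
  `quasiIso_shift_iff`);
* **`quasiIso_mapBifunctorMap_single`** — the same for `E₀[k]`, any `k : ℤ` (`E₀[k] ≅ E₀[0]⟦-k⟧`, Mathlib `SingleFunctors.shiftIso`).

This is the one-term case of «`F(E•, –)` preserves quasi-isomorphisms for `E•` bounded with each `F(Eᵖ, –)` exact»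
(`Literature/Algebra/Homology/MapBifunctorQuasiIso`), the homological-algebra half of the Tor-independent box of two resolutions
(`AlgebraicGeometry/Modules/BoxTensorResolution`). The template is the tree's internal-Hom column isomorphism
`HodgeTheory/HomComplex.columnIso` (contravariant first variable); here the bifunctor is covariant and the fixed complex sits in the
FIRST slot of `mapBifunctor`.

## References

* C. A. Weibel, *An introduction to homological algebra* (1994), 1.2.6 (total complex), 2.7.1 (tensor product of complexes), 1.2.8/10.1 (shifts). [Weibel1994]
* The Stacks Project, Tag 012Z (Definition 12.18.3, total complex and its signs). [StacksProject]
-/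

noncomputable section

-- `GradedObject`/`HomologicalComplex₂.toGradedObject` are not reducible (as in Mathlib's `Algebra/Homology/TotalComplex.lean`).
set_option backward.isDefEq.respectTransparency false

open CategoryTheory CategoryTheory.Category CategoryTheory.Limits HomologicalComplex

universe v₁ v₂ v₃ u₁ u₂ u₃

namespace Literature.Algebra.Homology

/-! ### §1 The column isomorphism `F(E₀[0], K•) ≅ F(E₀, –)•K•` -/

section Column

variable {C₁ : Type u₁} [Category.{v₁} C₁] [Preadditive C₁] [HasZeroObject C₁]
  {C₂ : Type u₂} [Category.{v₂} C₂] [Preadditive C₂]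
  {D : Type u₃} [Category.{v₃} D] [Preadditive D]
  (F : C₁ ⥤ C₂ ⥤ D) [F.PreservesZeroMorphisms] [∀ X₁, (F.obj X₁).PreservesZeroMorphisms]
  [∀ (K₁ : CochainComplex C₁ ℤ) (K₂ : CochainComplex C₂ ℤ), HasMapBifunctor K₁ K₂ F (ComplexShape.up ℤ)]
  (E₀ : C₁) (K : CochainComplex C₂ ℤ)

/-- `E₀[0]`, the object `E₀` as a cochain complex concentrated in degree `0`. [folklore] -/
abbrev single₀ : CochainComplex C₁ ℤ := (single C₁ (ComplexShape.up ℤ) 0).obj E₀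

/-- The summand inclusion `F(E₀[0]ⁱ, Kʲ) ⟶ F(E₀[0], K•)ⁿ`, `i + j = n`. [cite: Weibel1994, 1.2.6] -/
abbrev ι (i j n : ℤ) (h : i + j = n) :
    (F.obj ((single₀ E₀).X i)).obj (K.X j) ⟶ (mapBifunctor (single₀ E₀) K F (ComplexShape.up ℤ)).X n :=
  ιMapBifunctor (single₀ E₀) K F (ComplexShape.up ℤ) i j n h

variable {E₀} in
omit [HasZeroObject C₁] [Preadditive C₂] [∀ X₁, (F.obj X₁).PreservesZeroMorphisms]
  [∀ (K₁ : CochainComplex C₁ ℤ) (K₂ : CochainComplex C₂ ℤ), HasMapBifunctor K₁ K₂ F (ComplexShape.up ℤ)] in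
/-- `F(X, Y)` is a zero object when `X` is (`F` preserves zero morphisms in the first variable). [cite: Weibel1994, 2.6 (additive functors)] -/
theorem isZero_obj_obj_of_isZero_left {X : C₁} (hX : IsZero X) (Y : C₂) : IsZero ((F.obj X).obj Y) := by
  rw [IsZero.iff_id_eq_zero, ← NatTrans.id_app, ← F.map_id, hX.eq_of_src (𝟙 X) 0, F.map_zero, zero_app]

/-- Degree-`n` comparison `F(E₀[0], K•)ⁿ ⟶ F(E₀, Kⁿ)`: `F(E₀[0]⁰ ≅ E₀, Kⁿ)` on the summand `(0, n)`, zero elsewhere. [folklore] -/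
def columnHom (n : ℤ) : (mapBifunctor (single₀ E₀) K F (ComplexShape.up ℤ)).X n ⟶ (F.obj E₀).obj (K.X n) :=
  mapBifunctorDesc fun i j (hij : i + j = n) =>
    if hi : i = 0 then
      (F.map (singleObjXIsoOfEq (ComplexShape.up ℤ) 0 E₀ i hi).hom).app (K.X j) ≫ (F.obj E₀).map (K.XIsoOfEq (by omega)).hom
    else 0

/-- Degree-`n` inverse comparison `F(E₀, Kⁿ) ⟶ F(E₀[0]⁰, Kⁿ) ⟶ F(E₀[0], K•)ⁿ`. [folklore] -/
def columnInv (n : ℤ) : (F.obj E₀).obj (K.X n) ⟶ (mapBifunctor (single₀ E₀) K F (ComplexShape.up ℤ)).X n :=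
  (F.map (singleObjXSelf (ComplexShape.up ℤ) 0 E₀).inv).app (K.X n) ≫ ι F E₀ K 0 n n (zero_add n)

/-- `columnHom` on the summand `(0, n)`. [cite: Weibel1994, 1.2.6] -/
theorem ι_columnHom_zero (n : ℤ) :
    ι F E₀ K 0 n n (zero_add n) ≫ columnHom F E₀ K n = (F.map (singleObjXSelf (ComplexShape.up ℤ) 0 E₀).hom).app (K.X n) := by
  refine (ι_mapBifunctorDesc _ 0 n _).trans ?_
  rw [dif_pos rfl]
  change _ ≫ (F.obj E₀).map (eqToHom rfl) = _
  rw [eqToHom_refl, CategoryTheory.Functor.map_id, comp_id]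
  rfl

/-- `columnHom` vanishes on the summands `(i, j)`, `i ≠ 0` (their source is a zero object). [cite: Weibel1994, 1.2.6] -/
theorem ι_columnHom_of_ne (i j n : ℤ) (h : i + j = n) (hi : i ≠ 0) : ι F E₀ K i j n h ≫ columnHom F E₀ K n = 0 :=
  (isZero_obj_obj_of_isZero_left F (isZero_single_obj_X (ComplexShape.up ℤ) 0 E₀ i hi) (K.X j)).eq_of_src _ _

/-- `columnHom ≫ columnInv = 𝟙`. [cite: Weibel1994, 1.2.6] -/
theorem columnHom_columnInv (n : ℤ) : columnHom F E₀ K n ≫ columnInv F E₀ K n = 𝟙 _ := by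
  refine mapBifunctor.hom_ext fun i j (hij : i + j = n) => ?_
  by_cases hi : i = 0
  · subst hi
    obtain rfl : j = n := by omega
    rw [reassoc_of% (ι_columnHom_zero F E₀ K j), comp_id, columnInv, ← Category.assoc, ← NatTrans.comp_app,
      ← F.map_comp, Iso.hom_inv_id, F.map_id, NatTrans.id_app, id_comp]
  · exact (isZero_obj_obj_of_isZero_left F (isZero_single_obj_X (ComplexShape.up ℤ) 0 E₀ i hi) (K.X j)).eq_of_src _ _

/-- `columnInv ≫ columnHom = 𝟙`. [cite: Weibel1994, 1.2.6] -/
theorem columnInv_columnHom (n : ℤ) : columnInv F E₀ K n ≫ columnHom F E₀ K n = 𝟙 _ := by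
  rw [columnInv, Category.assoc, ι_columnHom_zero, ← NatTrans.comp_app, ← F.map_comp, Iso.inv_hom_id, F.map_id,
    NatTrans.id_app]

/-- Degreewise isomorphism `F(E₀[0], K•)ⁿ ≅ F(E₀, Kⁿ)`. [folklore] -/
def columnXIso (n : ℤ) : (mapBifunctor (single₀ E₀) K F (ComplexShape.up ℤ)).X n ≅ (F.obj E₀).obj (K.X n) where
  hom := columnHom F E₀ K n
  inv := columnInv F E₀ K n
  hom_inv_id := columnHom_columnInv F E₀ K n
  inv_hom_id := columnInv_columnHom F E₀ K n

/-- The first-variable differential of `F(E₀[0], K•)` vanishes (`E₀[0]` has zero differential). [cite: Weibel1994, 1.2.6] -/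
theorem column_D₁_eq_zero (n n' : ℤ) : mapBifunctor.D₁ (single₀ E₀) K F (ComplexShape.up ℤ) n n' = 0 := by
  refine mapBifunctor.hom_ext fun i j (hij : i + j = n) => ?_
  rw [comp_zero, mapBifunctor.ι_D₁,
    mapBifunctor.d₁_eq' _ _ _ _ (show (ComplexShape.up ℤ).Rel i (i + 1) by simp) _ _, single_obj_d, F.map_zero,
    zero_app, zero_comp, smul_zero]

/-- On the summand `(0, n)` the second-variable differential of `F(E₀[0], K•)` is `F(E₀[0]⁰, d_K)` followed by the
inclusion of the summand `(0, n + 1)` (the sign `ε₂(0, n) = (-1)⁰` is `1`). [cite: StacksProject, Tag 012Z] -/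
theorem ι_column_D₂ (n : ℤ) :
    ι F E₀ K 0 n n (zero_add n) ≫ mapBifunctor.D₂ (single₀ E₀) K F (ComplexShape.up ℤ) n (n + 1) =
      (F.obj ((single₀ E₀).X 0)).map (K.d n (n + 1)) ≫ ι F E₀ K 0 (n + 1) (n + 1) (zero_add _) := by
  rw [mapBifunctor.ι_D₂,
    mapBifunctor.d₂_eq _ _ _ _ 0 (show (ComplexShape.up ℤ).Rel n (n + 1) by simp) (n + 1) (zero_add _)]
  change ((ComplexShape.up ℤ).ε (0 : ℤ)) • _ = _
  rw [ComplexShape.ε_zero, one_smul]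

/-- **The column isomorphism** `F(E₀[0], K•) ≅ F(E₀, –)•K•`: for a complex concentrated in degree `0` in the first variable the
total complex is `F(E₀, –)` applied termwise (no sign). [cite: Weibel1994, 1.2.6 and 2.7.1] [cite: StacksProject, Tag 012Z] -/
def columnIso :
    mapBifunctor (single₀ E₀) K F (ComplexShape.up ℤ) ≅ ((F.obj E₀).mapHomologicalComplex (ComplexShape.up ℤ)).obj K :=
  Hom.isoOfComponents (fun n => columnXIso F E₀ K n) fun n n' hnn' => by
    obtain rfl : n + 1 = n' := hnn'
    change columnHom F E₀ K n ≫ (F.obj E₀).map (K.d n (n + 1)) =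
      (mapBifunctor (single₀ E₀) K F (ComplexShape.up ℤ)).d n (n + 1) ≫ columnHom F E₀ K (n + 1)
    refine mapBifunctor.hom_ext fun i j (hij : i + j = n) => ?_
    by_cases hi : i = 0
    · subst hi
      obtain rfl : j = n := by omega
      rw [reassoc_of% (ι_columnHom_zero F E₀ K j), mapBifunctor.d_eq, Preadditive.add_comp, Preadditive.comp_add,
        column_D₁_eq_zero, zero_comp, comp_zero, zero_add, reassoc_of% (ι_column_D₂ F E₀ K j), ι_columnHom_zero]
      exact ((F.map (singleObjXSelf (ComplexShape.up ℤ) 0 E₀).hom).naturality (K.d j (j + 1))).symm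
    · rw [reassoc_of% (ι_columnHom_of_ne F E₀ K i j n hij hi), zero_comp]
      exact (isZero_obj_obj_of_isZero_left F (isZero_single_obj_X (ComplexShape.up ℤ) 0 E₀ i hi) (K.X j)).eq_of_src _ _

/-- Degree-`n` component of the column isomorphism. [cite: Weibel1994, 1.2.6] -/
theorem columnIso_hom_f (n : ℤ) : (columnIso F E₀ K).hom.f n = columnHom F E₀ K n := rfl

variable {K} {K' : CochainComplex C₂ ℤ} (φ : K ⟶ K')

/-- **The column isomorphism is natural in `K•`.** [cite: Weibel1994, 1.2.6 and 2.7.1] -/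
theorem columnIso_hom_naturality :
    mapBifunctorMap (𝟙 (single₀ E₀)) φ F (ComplexShape.up ℤ) ≫ (columnIso F E₀ K').hom =
      (columnIso F E₀ K).hom ≫ ((F.obj E₀).mapHomologicalComplex (ComplexShape.up ℤ)).map φ := by
  refine HomologicalComplex.hom_ext _ _ fun n => ?_
  change (mapBifunctorMap (𝟙 (single₀ E₀)) φ F (ComplexShape.up ℤ)).f n ≫ columnHom F E₀ K' n =
    columnHom F E₀ K n ≫ (F.obj E₀).map (φ.f n)
  refine mapBifunctor.hom_ext fun i j (hij : i + j = n) => ?_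
  by_cases hi : i = 0
  · subst hi
    obtain rfl : j = n := by omega
    rw [ι_mapBifunctorMap_assoc, id_f, F.map_id, NatTrans.id_app, id_comp]
    erw [ι_columnHom_zero, reassoc_of% (ι_columnHom_zero F E₀ K j)]
    exact (F.map (singleObjXSelf (ComplexShape.up ℤ) 0 E₀).hom).naturality (φ.f j)
  · rw [reassoc_of% (ι_columnHom_of_ne F E₀ K i j n hij hi), zero_comp]
    exact (isZero_obj_obj_of_isZero_left F (isZero_single_obj_X (ComplexShape.up ℤ) 0 E₀ i hi) (K.X j)).eq_of_src _ _

end Column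

/-! ### §2 Quasi-isomorphisms: the one-term complex in degree `0`, invariance under `E ≅ E'` and under shifts -/

section QuasiIso

variable {C₁ : Type u₁} [Category.{v₁} C₁] [Preadditive C₁] [HasZeroObject C₁]
  {C₂ : Type u₂} [Category.{v₂} C₂] [Preadditive C₂]
  {D : Type u₃} [Category.{v₃} D] [Abelian D]
  (F : C₁ ⥤ C₂ ⥤ D) [F.Additive] [∀ X₁, (F.obj X₁).Additive]
  [∀ (K₁ : CochainComplex C₁ ℤ) (K₂ : CochainComplex C₂ ℤ), HasMapBifunctor K₁ K₂ F (ComplexShape.up ℤ)]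
  {K K' : CochainComplex C₂ ℤ} (φ : K ⟶ K')

/-- **Base case in degree `0`**: if `F(E₀, –)•φ` is a quasi-isomorphism, so is `F(E₀[0], –)•φ = mapBifunctorMap (𝟙 E₀[0]) φ`
(transport along the natural column isomorphism). [cite: Weibel1994, 2.7.1 and 1.2.6] -/
theorem quasiIso_mapBifunctorMap_single₀ (E₀ : C₁)
    (h : QuasiIso (((F.obj E₀).mapHomologicalComplex (ComplexShape.up ℤ)).map φ)) :
    QuasiIso (mapBifunctorMap (𝟙 (single₀ E₀)) φ F (ComplexShape.up ℤ)) := by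
  refine quasiIso_of_arrow_mk_iso (((F.obj E₀).mapHomologicalComplex (ComplexShape.up ℤ)).map φ) _
    (Arrow.isoMk (columnIso F E₀ K).symm (columnIso F E₀ K').symm ?_)
  change (columnIso F E₀ K).inv ≫ mapBifunctorMap (𝟙 (single₀ E₀)) φ F (ComplexShape.up ℤ) =
    ((F.obj E₀).mapHomologicalComplex (ComplexShape.up ℤ)).map φ ≫ (columnIso F E₀ K').inv
  rw [Iso.inv_comp_eq, ← Category.assoc, Iso.eq_comp_inv, columnIso_hom_naturality]

omit [HasZeroObject C₁] in
/-- `QuasiIso (F(E, –)•φ)` is invariant under isomorphisms `E ≅ E'` of the fixed complex (bifunctoriality of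
`F.map₂CochainComplex`). [cite: Weibel1994, 2.7.1] -/
theorem quasiIso_map₂_obj_map_iff_of_iso {E E' : CochainComplex C₁ ℤ} (e : E ≅ E') :
    QuasiIso (mapBifunctorMap (𝟙 E) φ F (ComplexShape.up ℤ)) ↔ QuasiIso (mapBifunctorMap (𝟙 E') φ F (ComplexShape.up ℤ)) := by
  have hsq : (F.map₂CochainComplex.map e.hom).app K ≫ (F.map₂CochainComplex.obj E').map φ =
      (F.map₂CochainComplex.obj E).map φ ≫ (F.map₂CochainComplex.map e.hom).app K' :=
    ((F.map₂CochainComplex.map e.hom).naturality φ).symm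
  let ea : Arrow.mk (mapBifunctorMap (𝟙 E) φ F (ComplexShape.up ℤ)) ≅ Arrow.mk (mapBifunctorMap (𝟙 E') φ F (ComplexShape.up ℤ)) :=
    Arrow.isoMk ((F.map₂CochainComplex.mapIso e).app K) ((F.map₂CochainComplex.mapIso e).app K') (by exact hsq)
  exact ⟨fun h => haveI := h; quasiIso_of_arrow_mk_iso _ _ ea, fun h => haveI := h; quasiIso_of_arrow_mk_iso _ _ ea.symm⟩

omit [HasZeroObject C₁] in
/-- `QuasiIso (F(E, –)•φ)` is invariant under shifting the fixed complex: `F(E⟦a⟧, –)•φ ≅ (F(E, –)•φ)⟦a⟧'` (Mathlib's sign-free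
`mapBifunctorShift₁Iso`, natural in the second variable) and `quasiIso_shift_iff`. [cite: Weibel1994, 1.2.8 and 2.7.1] -/
theorem quasiIso_map₂_obj_shift_map_iff (E : CochainComplex C₁ ℤ) (a : ℤ) :
    QuasiIso (mapBifunctorMap (𝟙 (E⟦a⟧)) φ F (ComplexShape.up ℤ)) ↔ QuasiIso (mapBifunctorMap (𝟙 E) φ F (ComplexShape.up ℤ)) := by
  have hsq := NatTrans.shift_app_comm (F.map₂CochainComplex.flip.map φ) a E
  -- `hsq : Shift₁Iso.hom.app E ≫ (F(E,–)•φ)⟦a⟧' = F(E⟦a⟧,–)•φ ≫ Shift₁Iso.hom.app E`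
  let ea : Arrow.mk (mapBifunctorMap (𝟙 (E⟦a⟧)) φ F (ComplexShape.up ℤ)) ≅
      Arrow.mk ((mapBifunctorMap (𝟙 E) φ F (ComplexShape.up ℤ))⟦a⟧') :=
    Arrow.isoMk (((F.map₂CochainComplex.flip.obj K).commShiftIso a).app E)
      (((F.map₂CochainComplex.flip.obj K').commShiftIso a).app E) (by exact hsq)
  rw [← CochainComplex.quasiIso_shift_iff (mapBifunctorMap (𝟙 E) φ F (ComplexShape.up ℤ)) a]
  exact ⟨fun h => haveI := h; quasiIso_of_arrow_mk_iso _ _ ea, fun h => haveI := h; quasiIso_of_arrow_mk_iso _ _ ea.symm⟩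

/-- **Base case in any degree `k`**: if `F(E₀, –)•φ` is a quasi-isomorphism, so is `F(E₀[k], –)•φ` (`E₀[k] ≅ E₀[0]⟦-k⟧` by Mathlib's
`SingleFunctors.shiftIso`, then §2's two invariances and the degree-`0` case). [cite: Weibel1994, 2.7.1, 1.2.6 and 1.2.8] -/
theorem quasiIso_mapBifunctorMap_single (E₀ : C₁) (k : ℤ)
    (h : QuasiIso (((F.obj E₀).mapHomologicalComplex (ComplexShape.up ℤ)).map φ)) :
    QuasiIso (mapBifunctorMap (𝟙 ((single C₁ (ComplexShape.up ℤ) k).obj E₀)) φ F (ComplexShape.up ℤ)) := by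
  have e : ((single C₁ (ComplexShape.up ℤ) 0).obj E₀)⟦-k⟧ ≅ (single C₁ (ComplexShape.up ℤ) k).obj E₀ :=
    ((CochainComplex.singleFunctors C₁).shiftIso (-k) k 0 (by omega)).app E₀
  rw [← quasiIso_map₂_obj_map_iff_of_iso F φ e, quasiIso_map₂_obj_shift_map_iff]
  exact quasiIso_mapBifunctorMap_single₀ F φ E₀ h

end QuasiIso

end Literature.Algebra.Homology

end
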